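import Summits.QuantumFields.BalabanUV.Beta.EriceRemainderEnclosureHistoryAutonomyComparisonNonlinearSize

/-!
# EriceRemainderEnclosureHistoryAutonomyComparisonNonlinearRelativeSize — (E124) **COMPARISON AT ANY STEEPNESS FOR EVERY ISOTONE EXCESS THAT IS SMALL RELATIVE TO
# THE LEVEL PER AGE** — the heavy-row form of (E121e)∕(E121f).  `B u = β₀ + Σ_{k<K} L_k·u_k` (`β₀ > 0`, `L ≥ 0`, `L_0 = 0`; profile, range `K`, sizes, loads ARBITRARY);
# `B′ ≥ B` with a modulus, the excess `E = B′ − B` ISOTONE (no modulus ∕ steepness condition).  The ONLY place where (E121e) used `e ≤ β₀∕10` (and (E121f) the pin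
# level `a_0`) is the price of the variation-route extra `e_m·h_m²` (`m = n+k+1`) at the loaded age `k` of row `n`: what the price needs is EXACTLY
# `e_m·(k−1) ≤ a_m∕10`, `a_m = 1∕h_m²` the LEVEL of the base orbit `k+1` rows below the row — (E121e) credited the level only with `β₀` per row (`a_m ≥ (k+1)β₀`), (E121f)
# with the head (`a_m ≥ a_0 + (k+1)β₀`); in a HEAVY tower the level is built by the MEMORY slope `Σ_j L_j h_{m+j} ≫ β₀`, and the honest condition is weaker by that
# factor.  THIS FILE runs the induction under the RELATIVE-SIZE CONDITION **`E(S h_m)·(k−1) ≤ a_m∕10` for every loaded age `2 ≤ k < K` and every depth `m ≥ k+1`**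
# (equivalently `E(h_m, h_{m+1}, …)·(min(m,K) − 2) ≤ (1∕h_m²)∕10` for `m ≥ 3`): the excess READ ON THE BASE ORBIT at depth `m` is at most a tenth of the level there per
# loaded age — the mean slope `a_m∕m` over the first `m` rows, memory included.  Inside the induction the excess at the perturbed configuration `e_m = E(S′h_m)` is
# `≤ E(S h_m)` by the comparison of configuration `m` (part of the induction hypothesis) and isotonicity, so the hypothesis is stated on the BASE family only.
# (**`defect_level_le`**) the price; (**`gauge_step_level`**, **`steps_nonneg_gauge_level`**) the step and the induction (with the variation bound, base = the light deep
# region as in (E121e)); finals (**`effective_le_level`**) `B(S h_i) ≤ B′(S′h_i)` at every orbit pin, (**`le_of_isotone_excess_level`**, family-free) `h′ ≤ h` at every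
# scale.  COROLLARIES by `a_m ≥ a_0 + m·β₀`: (E121e) `le_of_small_isotone_excess` (`E ≤ β₀∕10`), (E121f) `le_of_isotone_excess_sizepin` ∕ `_uv` — and NEW: deep pins of
# heavy towers with an excess up to a tenth of the MEAN SLOPE per loaded age, however larger than `β₀∕10` and than `a_0∕(10(K−2))`.
#
# NUMERICAL CONTEXT (gen 100, renormalised continuum solver, kit jobs j344145: towers with kernel first moment `T₀` up to ≈ 4): the infimum of `X∕E(S′y)` over pins is
# attained in the LINEAR regime (`η → 0`, covered here and by (E121e)) and `X∕η` increases with the amplitude; the part of OPEN (1) of `g99∕README.md` §4 left open by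
# this file is `E(S h_m)·(k−1) > a_m∕10` at some loaded age, where the solver finds `X∕η ≥ 0.14` at `T₀ = 2.4` and no sign change.  Evidence, not proof.

Cell `pub-balaban`, β-function sub-cell, BINDER row D4 «RemainderConst leaves for Bałaban's split» (`HOME/BINDER-OWNERS.md`; owner lineage `b2b-balaban-beta-an4`;
this file by co-owner #2 lineage `b2b-balaban-beta-d4-p2`, generation 100), β-FLOW TEAM duty (1), FREEZE (0) honoured (def-free; imports (E121e); uses (E118a)
`affine_facts`, (E119b) `excess_facts` ∕ `cmp_of_steps_nonneg` ∕ `excess_orbit_antitone`, (E120b) `base_gauge_light`, (E121a) `conf_incr_ge_var`, (E121b)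
`exists_base_depth_var` ∕ `var_base`, (E121d) `gauge_step_of_defect`, (E121e) `excess_le_head`, (E49j) `effective_le_of_small_pin`, (E49k) `family_le_of_orbit`, (E39)
`exists_memFlow_zm`, (E43b) `memFlow_unique_of_monotone_zm`, (E48a) `family_mem` ∕ `family_zero` ∕ `family_tail_eq` ∕ `strictAnti_of_memFlow` BY NAME; the proofs are
(E121f)'s re-run with the level kept — nothing else restated).

HONEST FRAMING (page 1, verbatim and binding).  *"Discharging BetaPertH makes Bałaban's UV stability UNCONDITIONAL — a real constructive-QFT result; it is
NOT the continuum limit and NOT the Clay problem."*  THIS FILE DISCHARGES NOTHING OF THE KIND.  Elementary real analysis about ABSTRACT functionals on a box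
]0,γ]^ℕ with displayed floors, moduli, profiles and signs — hypotheses of a census, not facts; the form, signs, ages and moments of Bałaban's (1.22) limit
functional are NOT PRINTED ([I] p. 298; GAPS G-t4-U2-1∕-2) and NOT asserted.  Row D4 class UNCHANGED (critical-path width 0; instance 0∕1; D4 DISCHARGE NO
DATE).  HONEST DEPENDENCY: continuum YM on T⁴ ⇐ BetaPertH ∧ nine spine estimates (0/9 proved); BetaPertH ⇐ (D1) ∧ (D4) ∧ CAP+tail; G-an2-4 gates asym, D1
and NE2/3/4.  NOT CLAIMED: excesses exceeding a tenth of the level per loaded age somewhere along the orbit, Markov weight `L_0 > 0`, anything printed — NOT B12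
Thm 2, NOT BetaPertH, NOT continuum, NOT Clay.

WHAT IS PROVED ([folklore]; 0 `def`, 0 sorry).  §1 **`defect_level_le`**, **`gauge_step_level`**.  §2 **`steps_nonneg_gauge_level`**.  §3 **`effective_le_level`**,
**`le_of_isotone_excess_level`**.
-/

noncomputable section
open Finset Set

namespace Summit.QuantumFields.BalabanUV.Beta.EriceRemainderEnclosureHistoryAutonomyComparisonNonlinearRelativeSize

open Literature.MathematicalPhysics.QuantumFieldTheory.Balaban1983to89
open Literature.MathematicalPhysics.QuantumFieldTheory.Balaban1983to89.T4BetaStationary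
open Literature.MathematicalPhysics.QuantumFieldTheory.Balaban1983to89.T4BetaFlowWellPosed
open Summit.QuantumFields.BalabanUV.Beta.EriceRemainderEnclosureHistoryAutonomyOrder (family_mem family_zero family_tail_eq le_of_pin_le strictAnti_of_memFlow)
open Summit.QuantumFields.BalabanUV.Beta.EriceRemainderEnclosureHistoryAutonomyComparisonExcess (effective_le_of_small_pin)
open Summit.QuantumFields.BalabanUV.Beta.EriceRemainderEnclosureHistoryAutonomyComparisonIsotoneExcess (family_le_of_orbit)
open Summit.QuantumFields.BalabanUV.Beta.EriceRemainderEnclosureHistoryAutonomyExistence (exists_memFlow_zm)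
open Summit.QuantumFields.BalabanUV.Beta.EriceRemainderEnclosureHistoryAutonomyMonotoneGeneral (memFlow_unique_of_monotone_zm)
open Summit.QuantumFields.BalabanUV.Beta.EriceRemainderEnclosureHistoryAutonomyComparisonNonlinearRowPrep (affine_facts)
open Summit.QuantumFields.BalabanUV.Beta.EriceRemainderEnclosureHistoryAutonomyComparisonNonlinearModulusPrep
  (excess_facts cmp_of_steps_nonneg excess_orbit_antitone)
open Summit.QuantumFields.BalabanUV.Beta.EriceRemainderEnclosureHistoryAutonomyComparisonNonlinearLightBase (base_gauge_light)
open Summit.QuantumFields.BalabanUV.Beta.EriceRemainderEnclosureHistoryAutonomyComparisonNonlinearVariationPrep (conf_incr_ge_var)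
open Summit.QuantumFields.BalabanUV.Beta.EriceRemainderEnclosureHistoryAutonomyComparisonNonlinearVariationBase (exists_base_depth_var var_base)
open Summit.QuantumFields.BalabanUV.Beta.EriceRemainderEnclosureHistoryAutonomyComparisonNonlinearGaugeDefect (gauge_step_of_defect)
open Summit.QuantumFields.BalabanUV.Beta.EriceRemainderEnclosureHistoryAutonomyComparisonNonlinearSize (excess_le_head)

variable {B B' : (ℕ → ℝ) → ℝ} {γ β₀ M' : ℝ} {L : ℕ → ℝ} {K : ℕ} {S S' : ℝ → ℕ → ℝ}

/-! ## §1 The price with the level kept; the step -/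

/-- **THE SIZE DEFECT AT AN AGE `k ≥ 1` IS AT MOST A TWENTIETH OF ITS SHARE, when `e·(k−1) ≤ a_{n+1+k}∕10`** (`a_{n+1+k} = 1∕h_{n+1+k}²` the LEVEL of the orbit
`k+1` rows below the row `n`): along a box solution `h` of a memory with floor `β₀`, with the interior window bounded through the gauge (`0 ≤ S ≤ ε1·h_{n+1}²·Σ_{1≤l<k}
a_{n+1+l}`, `ε1 ≥ 0`), `(L_kh_{n+1+k}³∕2)·(e·h_{n+k+1}²)·S ≤ (1∕20)·L_kh_{n+1+k}·h_{n+1}²·ε1` — every window level is `≤ a_{n+1+k}`.  (E121b) `defect_size_le` (`e ≤ β₀∕10`,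
`a_{n+1+k} ≥ (k+1)β₀`) and (E121f) `defect_sizepin_le` (`a_{n+1+k} ≥ a_0 + (k+1)β₀`) are the instances that forget the memory's contribution to the level. [folklore] -/
theorem defect_level_le {h : ℕ → ℝ} {y e : ℝ} (hL : ∀ k, 0 ≤ L k) (hβ : 0 < β₀) (hlo : ∀ u, SeqBox γ u → β₀ ≤ B u)
    (hh : SeqBox γ h) (hf : MemFlow B y h) (he0 : 0 ≤ e) {k : ℕ} (n : ℕ) (hk : 1 ≤ k)
    (he : e * ((k : ℝ) - 1) ≤ 1 / h (n + k + 1) ^ 2 / 10)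
    {S ε1 : ℝ} (hε1 : 0 ≤ ε1) (hS : S ≤ ε1 * h (n + 1) ^ 2 * ∑ l ∈ Ico 1 k, 1 / h (n + 1 + l) ^ 2) :
    L k * h (n + 1 + k) ^ 3 / 2 * (e * h (n + k + 1) ^ 2) * S ≤ 1 / 20 * (L k * h (n + 1 + k) * h (n + 1) ^ 2 * ε1) := by
  have hpos : ∀ j, 0 < h j := fun j => (hh j).1
  have hanti := (strictAnti_of_memFlow hβ hlo hh hf).antitone
  have hx := hpos (n + 1 + k)
  rw [show n + k + 1 = n + 1 + k by ring] at he ⊢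
  -- the window: Σ_{l<k} a_{n+1+l} ≤ (k−1) a_{n+1+k}
  have hwin : ∑ l ∈ Ico 1 k, 1 / h (n + 1 + l) ^ 2 ≤ ((k : ℝ) - 1) * (1 / h (n + 1 + k) ^ 2) := by
    calc ∑ l ∈ Ico 1 k, 1 / h (n + 1 + l) ^ 2 ≤ ∑ l ∈ Ico 1 k, 1 / h (n + 1 + k) ^ 2 :=
          sum_le_sum fun l hl => one_div_le_one_div_of_le (pow_pos hx 2)
            (pow_le_pow_left₀ hx.le (hanti (by have := (mem_Ico.mp hl).2; omega)) 2)
      _ = ((k : ℝ) - 1) * (1 / h (n + 1 + k) ^ 2) := by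
          rw [sum_const, Nat.card_Ico, nsmul_eq_mul]; push_cast [hk]; ring
  have hS' : S ≤ ε1 * h (n + 1) ^ 2 * (((k : ℝ) - 1) * (1 / h (n + 1 + k) ^ 2)) :=
    hS.trans (mul_le_mul_of_nonneg_left hwin (by positivity))
  have hx2 : 0 < h (n + 1 + k) ^ 2 := pow_pos hx 2
  -- the level condition, multiplied through by h²: e (k−1) h² ≤ 1/10
  have hkey : e * (((k : ℝ) - 1) * h (n + 1 + k) ^ 2) ≤ 1 / 10 := by
    have h1 := mul_le_mul_of_nonneg_right he hx2.le
    have hc : h (n + 1 + k) ^ 2 * (1 / h (n + 1 + k) ^ 2) = 1 := mul_one_div_cancel hx2.ne'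
    have e1 : 1 / h (n + 1 + k) ^ 2 / 10 * h (n + 1 + k) ^ 2 = 1 / 10 := by
      linear_combination (1 / 10 : ℝ) * hc
    calc e * (((k : ℝ) - 1) * h (n + 1 + k) ^ 2) = e * ((k : ℝ) - 1) * h (n + 1 + k) ^ 2 := by ring
      _ ≤ 1 / h (n + 1 + k) ^ 2 / 10 * h (n + 1 + k) ^ 2 := h1
      _ = 1 / 10 := e1
  have hLh : 0 ≤ L k * h (n + 1 + k) := mul_nonneg (hL k) hx.le
  calc L k * h (n + 1 + k) ^ 3 / 2 * (e * h (n + 1 + k) ^ 2) * S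
      ≤ L k * h (n + 1 + k) ^ 3 / 2 * (e * h (n + 1 + k) ^ 2) * (ε1 * h (n + 1) ^ 2 * (((k : ℝ) - 1) * (1 / h (n + 1 + k) ^ 2))) := by
        have hLk := hL k
        exact mul_le_mul_of_nonneg_left hS' (by positivity)
    _ = (L k * h (n + 1 + k) * h (n + 1) ^ 2 * ε1) * (e * (((k : ℝ) - 1) * h (n + 1 + k) ^ 2)) / 2 := by
        have hc : h (n + 1 + k) ^ 2 * (1 / h (n + 1 + k) ^ 2) = 1 := mul_one_div_cancel hx2.ne'
        linear_combination (L k * h (n + 1 + k) ^ 3 / 2 * e * ε1 * h (n + 1) ^ 2 * ((k : ℝ) - 1)) * hc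
    _ ≤ (L k * h (n + 1 + k) * h (n + 1) ^ 2 * ε1) * (1 / 10) / 2 := by
        apply div_le_div_of_nonneg_right _ (by norm_num)
        exact mul_le_mul_of_nonneg_left hkey (by positivity)
    _ = 1 / 20 * (L k * h (n + 1 + k) * h (n + 1) ^ 2 * ε1) := by ring

set_option maxHeartbeats 800000 in
/-- **THE STEP OF THE ROW INDUCTION (isotone excess under the relative-size condition, any steepness).**  Along the base orbit `h = S y` let
`E(S h_m)·(k−1) ≤ a_m∕10` for `2 ≤ k < K`, `m ≥ k+1`.  If `X_m ≥ 0` and `G_{m+1} ≤ G_m` for `m ≥ n+1`, and the variation bound `Σ_{j<J} h_{m+j}²·Δe_{m+j} ≤ G_m` holds for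
`m ≥ n+2` and every `J`, then `G_{n+1} + (e_n − e_{n+1})·h_n² ≤ G_n` ((E121d) `gauge_step_of_defect` with (E121a) `conf_incr_ge_var` and `defect_level_le`; the
perturbed excess `e_m = E(S′h_m) ≤ E(S h_m)` by the comparison of configuration `m ≥ n+1` and isotonicity). [folklore] -/
theorem gauge_step_level (hBaff : ∀ u, SeqBox γ u → B u = β₀ + ∑ k ∈ range K, L k * u k) (hL : ∀ k, 0 ≤ L k) (hL0 : L 0 = 0) (hβ : 0 < β₀)
    (hB' : ∀ u u' : ℕ → ℝ, SeqBox γ u → SeqBox γ u' → ∀ D : ℝ, (∀ j, |u j - u' j| ≤ D) → |B' u - B' u'| ≤ M' * D) (hM' : 0 ≤ M')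
    (hexc : ∀ u, SeqBox γ u → B u ≤ B' u)
    (hDmono : ∀ u v : ℕ → ℝ, SeqBox γ u → SeqBox γ v → (∀ j, u j ≤ v j) → B' u - B u ≤ B' v - B v)
    (hS : ∀ p, 0 < p → p ≤ γ → SeqBox γ (S p) ∧ MemFlow B p (S p))
    (huniq : ∀ p, 0 < p → p ≤ γ → ∀ u u' : ℕ → ℝ, SeqBox γ u → SeqBox γ u' → MemFlow B p u → MemFlow B p u' → u = u')
    (hS' : ∀ p, 0 < p → p ≤ γ → SeqBox γ (S' p) ∧ MemFlow B' p (S' p))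
    (huniq' : ∀ p, 0 < p → p ≤ γ → ∀ u u' : ℕ → ℝ, SeqBox γ u → SeqBox γ u' → MemFlow B' p u → MemFlow B' p u' → u = u')
    {y : ℝ} (hy : 0 < y) (hyγ : y ≤ γ)
    (hElev : ∀ m k, 2 ≤ k → k < K → k + 1 ≤ m → (B' (S (S y m)) - B (S (S y m))) * ((k : ℝ) - 1) ≤ 1 / S y m ^ 2 / 10) (n : ℕ)
    (hX : ∀ m, n + 1 ≤ m → 0 ≤ B' (S' (S y m)) - B (S (S y m)))
    (hg : ∀ m, n + 1 ≤ m → (B' (S' (S y (m + 1))) - B (S (S y (m + 1)))) * S y (m + 1) ^ 2 ≤ (B' (S' (S y m)) - B (S (S y m))) * S y m ^ 2)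
    (hV : ∀ m, n + 2 ≤ m → ∀ J, ∑ j ∈ range J, S y (m + j) ^ 2
        * ((B' (S' (S y (m + j))) - B (S' (S y (m + j)))) - (B' (S' (S y (m + j + 1))) - B (S' (S y (m + j + 1)))))
        ≤ (B' (S' (S y m)) - B (S (S y m))) * S y m ^ 2) :
    (B' (S' (S y (n + 1))) - B (S (S y (n + 1)))) * S y (n + 1) ^ 2
        + ((B' (S' (S y n)) - B (S' (S y n))) - (B' (S' (S y (n + 1))) - B (S' (S y (n + 1))))) * S y n ^ 2
      ≤ (B' (S' (S y n)) - B (S (S y n))) * S y n ^ 2 := by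
  obtain ⟨hmono, hlo, _, _⟩ := affine_facts hBaff hL hβ
  have hh := (hS y hy hyγ).1
  have hf := (hS y hy hyγ).2
  have hpos : ∀ j, 0 < S y j := fun j => (hh j).1
  have hcmp := cmp_of_steps_nonneg hBaff hL hβ hB' hM' hexc hDmono hS huniq hS' huniq' hy hyγ n hX
  have htail : ∀ m i, S (S y m) i = S y (m + i) := fun m i => (congrFun (family_tail_eq hS huniq hy hyγ m) i).symm
  set e : ℕ → ℝ := fun i => B' (S' (S y i)) - B (S' (S y i)) with he_def
  have he := fun i => excess_le_head hBaff hL hβ hB' hM' hexc hDmono hS hS' huniq' hy hyγ i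
  -- the defect data
  set ξ : ℕ → ℝ := fun k => e (n + k + 1) * S y (n + k + 1) ^ 2 with hξ_def
  set θ : ℕ → ℝ := fun k => ∑ q ∈ Ico 1 K, L q * S y (n + k + 1 + q) ^ 3 / 2 + ξ k with hθ_def
  have hθ0 : ∀ k, 0 ≤ θ k := fun k => by
    have h1 : 0 ≤ ∑ q ∈ Ico 1 K, L q * S y (n + k + 1 + q) ^ 3 / 2 :=
      sum_nonneg fun q _ => by have := hL q; have := hpos (n + k + 1 + q); positivity
    have h2 : 0 ≤ ξ k := mul_nonneg (he (n + k + 1)).1 (sq_nonneg _)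
    simp only [hθ_def]; linarith
  have hdef : ∀ j, j + 1 < K → (1 / S' (S y (n + 1)) j ^ 2 - 1 / S y (n + 1 + j) ^ 2)
      - (1 / S' (S y (n + 1)) (j + 1) ^ 2 - 1 / S y (n + 1 + j + 1) ^ 2)
      ≤ θ (j + 1) * (1 / S' (S y (n + 1)) j ^ 2 - 1 / S y (n + 1 + j) ^ 2) := by
    intro j _
    have h := conf_incr_ge_var hBaff hL hL0 hβ hB' hM' hexc hDmono hS huniq hS' huniq' hy hyγ (n + 1) j (hcmp (n + 1) (by omega))
      (hcmp (n + 1 + 1 + j) (by omega)) (hV (n + 1 + 1 + j) (by omega))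
    rw [show n + 1 + 1 + j = n + (j + 1) + 1 by ring] at h
    exact h
  have hθle : ∀ k, 2 ≤ k → k < K → θ k ≤ ∑ q ∈ Ico 1 K, L q * S y (n + k + 1 + q) ^ 3 / 2 + ξ k := fun k _ _ => le_rfl
  have hprice : ∀ k, 2 ≤ k → k < K → ∀ W : ℝ, 0 ≤ W →
      W ≤ (B' (S' (S y (n + 1))) - B (S (S y (n + 1)))) * S y (n + 1) ^ 2 * ∑ l ∈ Ico 1 k, 1 / S y (n + 1 + l) ^ 2 →
      L k * S y (n + 1 + k) ^ 3 / 2 * ξ k * W ≤ 1 / 20 * (L k * S y (n + 1 + k) * S y (n + 1) ^ 2 * (B' (S' (S y (n + 1))) - B (S (S y (n + 1))))) := by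
    intro k hk2 hkK W _ hW
    have hk' : 0 ≤ (k : ℝ) - 1 := by have : (2 : ℝ) ≤ k := by exact_mod_cast hk2
                                     linarith
    -- the perturbed excess at configuration n+k+1 is below the base one there (comparison of that configuration, isotone excess)
    have hqm := family_mem hS hy hyγ (n + k + 1)
    have hle : B' (S' (S y (n + k + 1))) - B (S' (S y (n + k + 1))) ≤ B' (S (S y (n + k + 1))) - B (S (S y (n + k + 1))) :=
      hDmono _ _ (hS' _ hqm.1 hqm.2).1 (hS _ hqm.1 hqm.2).1 fun j => by rw [htail]; exact hcmp (n + k + 1) (by omega) j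
    have hek : (B' (S' (S y (n + k + 1))) - B (S' (S y (n + k + 1)))) * ((k : ℝ) - 1) ≤ 1 / S y (n + k + 1) ^ 2 / 10 :=
      (mul_le_mul_of_nonneg_right hle hk').trans (hElev (n + k + 1) k hk2 hkK (by omega))
    exact defect_level_le (B := B) (L := L) hL hβ hlo hh hf (he (n + k + 1)).1 n (by omega) hek (hX (n + 1) le_rfl) hW
  exact gauge_step_of_defect hBaff hL hβ hB' hM' hexc hDmono hS huniq hS' huniq' hy hyγ n hX hg hθ0 hdef hθle hprice

/-! ## §2 The nonlinear level gauge and the variation bound along every orbit -/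

/-- **THE NONLINEAR LEVEL GAUGE UNDER THE RELATIVE-SIZE CONDITION.**  Base affine (any profile, range, size; `L_0 = 0`); `B′ ≥ B` with modulus `M′`, isotone excess with
`E(S h_m)·(k−1) ≤ a_m∕10` for `2 ≤ k < K`, `m ≥ k+1` along the base orbit `h = S y`; unique solution families.  Then at EVERY depth `m`: `X_m ≥ 0`, `X_{m+1}h_{m+1}² ≤
X_mh_m²`, and `Σ_{j<J} h_{m+j}²·(e_{m+j} − e_{m+j+1}) ≤ X_mh_m²` for every `J` (row induction from the deep light region of (E121b) `exists_base_depth_var`, exactly as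
(E121e) `steps_nonneg_gauge_size` with `gauge_step_level`). [folklore] -/
theorem steps_nonneg_gauge_level (hBaff : ∀ u, SeqBox γ u → B u = β₀ + ∑ k ∈ range K, L k * u k) (hL : ∀ k, 0 ≤ L k) (hL0 : L 0 = 0) (hβ : 0 < β₀)
    (hB' : ∀ u u' : ℕ → ℝ, SeqBox γ u → SeqBox γ u' → ∀ D : ℝ, (∀ j, |u j - u' j| ≤ D) → |B' u - B' u'| ≤ M' * D) (hM' : 0 ≤ M')
    (hexc : ∀ u, SeqBox γ u → B u ≤ B' u)
    (hDmono : ∀ u v : ℕ → ℝ, SeqBox γ u → SeqBox γ v → (∀ j, u j ≤ v j) → B' u - B u ≤ B' v - B v)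
    (hS : ∀ p, 0 < p → p ≤ γ → SeqBox γ (S p) ∧ MemFlow B p (S p))
    (huniq : ∀ p, 0 < p → p ≤ γ → ∀ u u' : ℕ → ℝ, SeqBox γ u → SeqBox γ u' → MemFlow B p u → MemFlow B p u' → u = u')
    (hS' : ∀ p, 0 < p → p ≤ γ → SeqBox γ (S' p) ∧ MemFlow B' p (S' p))
    (huniq' : ∀ p, 0 < p → p ≤ γ → ∀ u u' : ℕ → ℝ, SeqBox γ u → SeqBox γ u' → MemFlow B' p u → MemFlow B' p u' → u = u')
    {y : ℝ} (hy : 0 < y) (hyγ : y ≤ γ)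
    (hElev : ∀ m k, 2 ≤ k → k < K → k + 1 ≤ m → (B' (S (S y m)) - B (S (S y m))) * ((k : ℝ) - 1) ≤ 1 / S y m ^ 2 / 10) :
    ∀ m, 0 ≤ B' (S' (S y m)) - B (S (S y m))
      ∧ (B' (S' (S y (m + 1))) - B (S (S y (m + 1)))) * S y (m + 1) ^ 2 ≤ (B' (S' (S y m)) - B (S (S y m))) * S y m ^ 2
      ∧ ∀ J, ∑ j ∈ range J, S y (m + j) ^ 2
          * ((B' (S' (S y (m + j))) - B (S' (S y (m + j)))) - (B' (S' (S y (m + j + 1))) - B (S' (S y (m + j + 1)))))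
        ≤ (B' (S' (S y m)) - B (S (S y m))) * S y m ^ 2 := by
  obtain ⟨hmono, hlo, hdom, hBmod⟩ := affine_facts hBaff hL hβ
  have hM : 0 ≤ ∑ k ∈ range K, L k := sum_nonneg fun k _ => hL k
  have hh := (hS y hy hyγ).1
  have hf := (hS y hy hyγ).2
  have hpos : ∀ j, 0 < S y j := fun j => (hh j).1
  -- the deep region
  obtain ⟨N₀, hN₀⟩ := exists_base_depth_var hBaff hL hβ hh hf
  have hXdeep : ∀ m, N₀ ≤ m → 0 ≤ B' (S' (S y m)) - B (S (S y m)) := by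
    intro m hm
    have hq := family_mem hS hy hyγ m
    have hsmall := (hN₀ m hm).1.2
    have := effective_le_of_small_pin hBmod hM hβ hlo hexc hDmono hq.1 hq.2 hsmall (hS _ hq.1 hq.2).1 (hS _ hq.1 hq.2).2
      (hS' _ hq.1 hq.2).1 (hS' _ hq.1 hq.2).2
    linarith
  -- P(n): non-negativity, the gauge and the variation bound at every m ≥ n
  have hP : ∀ d n, N₀ ≤ n + d → ∀ m, n ≤ m → 0 ≤ B' (S' (S y m)) - B (S (S y m))
      ∧ (B' (S' (S y (m + 1))) - B (S (S y (m + 1)))) * S y (m + 1) ^ 2 ≤ (B' (S' (S y m)) - B (S (S y m))) * S y m ^ 2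
      ∧ ∀ J, ∑ j ∈ range J, S y (m + j) ^ 2
          * ((B' (S' (S y (m + j))) - B (S' (S y (m + j)))) - (B' (S' (S y (m + j + 1))) - B (S' (S y (m + j + 1)))))
        ≤ (B' (S' (S y m)) - B (S (S y m))) * S y m ^ 2 := by
    intro d
    induction d with
    | zero =>
      intro n hn m hm
      rw [add_zero] at hn
      have hcmp := cmp_of_steps_nonneg hBaff hL hβ hB' hM' hexc hDmono hS huniq hS' huniq' hy hyγ m fun m' hm' => hXdeep m' (by omega)
      refine ⟨hXdeep m (hn.trans hm), ?_, ?_⟩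
      · exact base_gauge_light hBaff hL hL0 hβ hB' hM' hexc hDmono hS huniq hS' huniq' hy hyγ m (hN₀ m (hn.trans hm)).1.1 hcmp
          fun m' hm' => hXdeep m' (by omega)
      · exact var_base hBaff hL hβ hB' hM' hexc hDmono hS huniq hS' huniq' hy hyγ m (hN₀ m (hn.trans hm)).2 hcmp
    | succ d ih =>
      intro n hn m hm
      have ih' := ih (n + 1) (by omega)
      by_cases hm1 : n + 1 ≤ m
      · exact ih' m hm1
      · have hmn : m = n := by omega
        subst hmn
        have hXb : ∀ m', m + 1 ≤ m' → 0 ≤ B' (S' (S y m')) - B (S (S y m')) := fun m' hm' => (ih' m' hm').1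
        have hgb : ∀ m', m + 1 ≤ m' → (B' (S' (S y (m' + 1))) - B (S (S y (m' + 1)))) * S y (m' + 1) ^ 2
            ≤ (B' (S' (S y m')) - B (S (S y m'))) * S y m' ^ 2 := fun m' hm' => (ih' m' hm').2.1
        have hVb : ∀ m', m + 2 ≤ m' → ∀ J, ∑ j ∈ range J, S y (m' + j) ^ 2
            * ((B' (S' (S y (m' + j))) - B (S' (S y (m' + j)))) - (B' (S' (S y (m' + j + 1))) - B (S' (S y (m' + j + 1)))))
            ≤ (B' (S' (S y m')) - B (S (S y m'))) * S y m' ^ 2 := fun m' hm' => (ih' m' (by omega)).2.2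
        have hgs := gauge_step_level hBaff hL hL0 hβ hB' hM' hexc hDmono hS huniq hS' huniq' hy hyγ hElev m hXb hgb hVb
        have hΔe := (excess_orbit_antitone hBaff hL hβ hB' hM' hexc hDmono hS hS' huniq' hy hyγ m).2
        have hm2 : 0 < S y m ^ 2 := pow_pos (hpos m) 2
        have hΔe' : 0 ≤ ((B' (S' (S y m)) - B (S' (S y m))) - (B' (S' (S y (m + 1))) - B (S' (S y (m + 1))))) * S y m ^ 2 :=
          mul_nonneg (by linarith) hm2.le
        have hG1 : 0 ≤ (B' (S' (S y (m + 1))) - B (S (S y (m + 1)))) * S y (m + 1) ^ 2 := mul_nonneg (hXb (m + 1) le_rfl) (sq_nonneg _)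
        refine ⟨?_, by linarith, ?_⟩
        · have h1 : 0 ≤ (B' (S' (S y m)) - B (S (S y m))) * S y m ^ 2 := by linarith
          nlinarith
        · intro J
          cases J with
          | zero => simp only [range_zero, sum_empty]; linarith
          | succ J' =>
            rw [sum_range_succ']
            simp only [add_zero]
            have hrest := (ih' (m + 1) le_rfl).2.2 J'
            have e : ∑ j ∈ range J', S y (m + (j + 1)) ^ 2
                * ((B' (S' (S y (m + (j + 1)))) - B (S' (S y (m + (j + 1))))) - (B' (S' (S y (m + (j + 1) + 1))) - B (S' (S y (m + (j + 1) + 1)))))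
                = ∑ j ∈ range J', S y (m + 1 + j) ^ 2
                * ((B' (S' (S y (m + 1 + j))) - B (S' (S y (m + 1 + j)))) - (B' (S' (S y (m + 1 + j + 1))) - B (S' (S y (m + 1 + j + 1))))) :=
              sum_congr rfl fun j _ => by rw [show m + (j + 1) = m + 1 + j by ring]
            rw [e]
            linarith
  intro m
  exact hP N₀ 0 (by omega) m (Nat.zero_le m)

/-! ## §3 Comparison at any steepness for an isotone excess small relative to the level -/

/-- **THE EFFECTIVE β-FUNCTIONS OF `B` AND `B′` ARE ORDERED AT EVERY ORBIT PIN**, `B(S h_i) ≤ B′(S′h_i)` for every `i`, `h = S p` — affine base of any profile and size,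
isotone excess of any steepness and size, under the relative-size condition `E(S h_m)·(k−1) ≤ a_m∕10` (`2 ≤ k < K`, `m ≥ k+1`) along the orbit from `p` (the condition for
the sub-orbit from `h_i` is the condition at depths `i+m`). [folklore] -/
theorem effective_le_level (hBaff : ∀ u, SeqBox γ u → B u = β₀ + ∑ k ∈ range K, L k * u k) (hL : ∀ k, 0 ≤ L k) (hL0 : L 0 = 0) (hβ : 0 < β₀)
    (hB' : ∀ u u' : ℕ → ℝ, SeqBox γ u → SeqBox γ u' → ∀ D : ℝ, (∀ j, |u j - u' j| ≤ D) → |B' u - B' u'| ≤ M' * D) (hM' : 0 ≤ M')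
    (hexc : ∀ u, SeqBox γ u → B u ≤ B' u)
    (hDmono : ∀ u v : ℕ → ℝ, SeqBox γ u → SeqBox γ v → (∀ j, u j ≤ v j) → B' u - B u ≤ B' v - B v)
    {p : ℝ} (hp : 0 < p) (hpγ : p ≤ γ)
    (hS : ∀ p, 0 < p → p ≤ γ → SeqBox γ (S p) ∧ MemFlow B p (S p))
    (huniq : ∀ p, 0 < p → p ≤ γ → ∀ u u' : ℕ → ℝ, SeqBox γ u → SeqBox γ u' → MemFlow B p u → MemFlow B p u' → u = u')
    (hS' : ∀ p, 0 < p → p ≤ γ → SeqBox γ (S' p) ∧ MemFlow B' p (S' p))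
    (huniq' : ∀ p, 0 < p → p ≤ γ → ∀ u u' : ℕ → ℝ, SeqBox γ u → SeqBox γ u' → MemFlow B' p u → MemFlow B' p u' → u = u')
    (hlev : ∀ m k, 2 ≤ k → k < K → k + 1 ≤ m → (B' (S (S p m)) - B (S (S p m))) * ((k : ℝ) - 1) ≤ 1 / S p m ^ 2 / 10) :
    ∀ i, B (S (S p i)) ≤ B' (S' (S p i)) := by
  intro i
  have hq := family_mem hS hp hpγ i
  have htail : ∀ m, S (S p i) m = S p (i + m) := fun m => (congrFun (family_tail_eq hS huniq hp hpγ i) m).symm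
  have hElev : ∀ m k, 2 ≤ k → k < K → k + 1 ≤ m →
      (B' (S (S (S p i) m)) - B (S (S (S p i) m))) * ((k : ℝ) - 1) ≤ 1 / S (S p i) m ^ 2 / 10 := by
    intro m k hk2 hkK hkm
    rw [htail m]
    exact hlev (i + m) k hk2 hkK (by omega)
  have := (steps_nonneg_gauge_level hBaff hL hL0 hβ hB' hM' hexc hDmono hS huniq hS' huniq' hq.1 hq.2 hElev 0).1
  rw [family_zero hS hq.1 hq.2] at this
  linarith

/-- **COMPARISON AT ANY STEEPNESS FOR EVERY ISOTONE EXCESS SMALL RELATIVE TO THE LEVEL PER AGE, family-free form.**  `B u = β₀ + Σ_{k<K} L_k·u_k` on the box ]0,γ]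
with `β₀ > 0`, `L ≥ 0`, `L_0 = 0` — profile, range `K`, ALL SIZES AND LOADS ARBITRARY (no light-row condition); `B′ ≥ B` on the box with a modulus `M′ ≥ 0`, the
excess `E = B′ − B` ISOTONE (no modulus, steepness or global size condition); `h`, `h′` ANY box solutions of `B`, `B′` from one pin `p ∈ ]0,γ]`; and along the BASE
solution `h` the RELATIVE-SIZE CONDITION **`E(h_m, h_{m+1}, …)·(k−1) ≤ (1∕h_m²)∕10` for `2 ≤ k < K`, `m ≥ k+1`** — the excess read on the base history at depth `m` is at
most a tenth of the LEVEL there per loaded age (the mean slope over the first `m` rows, MEMORY INCLUDED).  Then `h′ ≤ h` at EVERY scale.  Since `1∕h_m² ≥ 1∕p² + m·β₀`,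
this contains (E121e) `le_of_small_isotone_excess` (`E ≤ β₀∕10`) and (E121f) `le_of_isotone_excess_sizepin` ∕ `_uv` (`10(K−2)·Esup ≤ 1∕p²`), and newly covers deep pins
of heavy towers with excesses up to a tenth of the mean memory slope per loaded age. [folklore] -/
theorem le_of_isotone_excess_level {p : ℝ} {h h' : ℕ → ℝ} (hBaff : ∀ u, SeqBox γ u → B u = β₀ + ∑ k ∈ range K, L k * u k) (hL : ∀ k, 0 ≤ L k)
    (hL0 : L 0 = 0) (hβ : 0 < β₀)
    (hB' : ∀ u u' : ℕ → ℝ, SeqBox γ u → SeqBox γ u' → ∀ D : ℝ, (∀ j, |u j - u' j| ≤ D) → |B' u - B' u'| ≤ M' * D) (hM' : 0 ≤ M')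
    (hexc : ∀ u, SeqBox γ u → B u ≤ B' u)
    (hDmono : ∀ u v : ℕ → ℝ, SeqBox γ u → SeqBox γ v → (∀ j, u j ≤ v j) → B' u - B u ≤ B' v - B v)
    (hp : 0 < p) (hpγ : p ≤ γ) (hh : SeqBox γ h) (hf : MemFlow B p h) (hh' : SeqBox γ h') (hf' : MemFlow B' p h')
    (hlev : ∀ m k, 2 ≤ k → k < K → k + 1 ≤ m →
      (B' (fun j => h (m + j)) - B (fun j => h (m + j))) * ((k : ℝ) - 1) ≤ 1 / h m ^ 2 / 10) (j : ℕ) :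
    h' j ≤ h j := by
  obtain ⟨hmono', hlo'⟩ := excess_facts hBaff hL hβ hexc hDmono
  obtain ⟨hmono, hlo, _, hBmod⟩ := affine_facts hBaff hL hβ
  have hM : 0 ≤ ∑ k ∈ range K, L k := sum_nonneg fun k _ => hL k
  have hγ : 0 < γ := hp.trans_le hpγ
  have hex : ∀ q : ℝ, 0 < q → q ≤ γ → ∃ k : ℕ → ℝ, SeqBox γ k ∧ MemFlow B q k := fun q hq hqγ => exists_memFlow_zm hBmod hM hq hqγ hβ hlo
  have hex' : ∀ q : ℝ, 0 < q → q ≤ γ → ∃ k : ℕ → ℝ, SeqBox γ k ∧ MemFlow B' q k := fun q hq hqγ => exists_memFlow_zm hB' hM' hq hqγ hβ hlo'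
  choose! S hSb hSf using hex
  choose! S' hS'b hS'f using hex'
  have hS : ∀ q, 0 < q → q ≤ γ → SeqBox γ (S q) ∧ MemFlow B q (S q) := fun q hq hqγ => ⟨hSb q hq hqγ, hSf q hq hqγ⟩
  have hS' : ∀ q, 0 < q → q ≤ γ → SeqBox γ (S' q) ∧ MemFlow B' q (S' q) := fun q hq hqγ => ⟨hS'b q hq hqγ, hS'f q hq hqγ⟩
  have huniq : ∀ q, 0 < q → q ≤ γ → ∀ u u' : ℕ → ℝ, SeqBox γ u → SeqBox γ u' → MemFlow B q u → MemFlow B q u' → u = u' :=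
    fun q hq _ u u' hu hu' hfu hfu' => memFlow_unique_of_monotone_zm hmono hBmod hM hq hβ hlo hu hu' hfu hfu'
  have huniq' : ∀ q, 0 < q → q ≤ γ → ∀ u u' : ℕ → ℝ, SeqBox γ u → SeqBox γ u' → MemFlow B' q u → MemFlow B' q u' → u = u' :=
    fun q hq _ u u' hu hu' hfu hfu' => memFlow_unique_of_monotone_zm hmono' hB' hM' hq hβ hlo' hu hu' hfu hfu'
  have e : h = S p := huniq p hp hpγ _ _ hh (hS p hp hpγ).1 hf (hS p hp hpγ).2
  have e' : h' = S' p := huniq' p hp hpγ _ _ hh' (hS' p hp hpγ).1 hf' (hS' p hp hpγ).2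
  have hlevS : ∀ m k, 2 ≤ k → k < K → k + 1 ≤ m → (B' (S (S p m)) - B (S (S p m))) * ((k : ℝ) - 1) ≤ 1 / S p m ^ 2 / 10 := by
    intro m k hk2 hkK hkm
    have ht : (fun j => S p (m + j)) = S (S p m) := family_tail_eq hS huniq hp hpγ m
    have := hlev m k hk2 hkK hkm
    rwa [e, ht] at this
  rw [e, e']
  exact family_le_of_orbit hβ hγ hB' hM' hlo' hS huniq hS' huniq' ⟨hp, hpγ⟩ (fun i _ =>
    effective_le_level hBaff hL hL0 hβ hB' hM' hexc hDmono hp hpγ hS huniq hS' huniq' hlevS i) j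

end Summit.QuantumFields.BalabanUV.Beta.EriceRemainderEnclosureHistoryAutonomyComparisonNonlinearRelativeSize

end
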